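import Summits.HodgeConjecture.HodgeConjecture.Theorems.Ring2AbelianAllAndrePolarPairsTop
import HarnessLib

/-!
# Ring 2 · sub-cell AbelianAll (ALL ABELIAN VARIETIES), André axis, part XXXVIII-g — TRIPLES OF POLAR CLASSES IN THE TOP DEGREE:
# the "three-pair matching formula" for `u v w y_a y_c y_e θᵏ` (`k + 3 = dim A`) on the rational carriers — the first half of the
# Kleiman identity of the block `b = 2` (abelian-FOURFOLD pencils), reducing six-fold products to the two-pair formula of part XXXVIII-e₁

HONEST FRAMING (page 1, verbatim): **research route, not a corollary; conditional on HC_CM plus one named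
minimal statement.** Cell line: research route conditional on HC_CM; not a corollary; Q11.4-sentence-2
already refuted in dim ≥ 3. Nothing in this file proves a case of the Hodge conjecture; `HC_CM` does not occur.

Gen-30 file of the `ab-andre-2` seat (cell `pub-hodge-ring2`, sub-cell AbelianAll = ALL abelian varieties, not Weil-type-only).

## What this file proves (sorry-free, standard axioms only; RATIONAL Betti carriers, COR-CM model layer)

For `A : AbelianVariety ℂ`, a basis `b` of `H¹(A(ℂ); ℚ)`, `θ` and its polar family `y` along `b` (`y_a = D_a θ` for the graded derivation
`D_a` of `H• = ⋀•H¹` extending `b^*_a`):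
* `smul_cup_cup_cup_polar_cupPow` (`k + 2 = dim A`) — **`(k+1) · u v w y_a θᵏ = b^*_a(w) · u v θ^{k+1} − b^*_a(v) · u w θ^{k+1} + b^*_a(u) · v w θ^{k+1}`**
  (`(k+1) y_a θᵏ = D_a(θ^{k+1})`, three Leibniz steps, `u v w θ^{k+1} = 0` above the top degree);
* `smul_cup6_polar3_cupPow` (`k + 3 = dim A`) — **the three-pair matching step**:
  `(k+1) · u v w y_a y_c y_e θᵏ = b^*_e(y_c) · u v w y_a θ^{k+1} − b^*_e(y_a) · u v w y_c θ^{k+1} + b^*_e(w) · u v y_a y_c θ^{k+1}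
   − b^*_e(v) · u w y_a y_c θ^{k+1} + b^*_e(u) · v w y_a y_c θ^{k+1}` (five Leibniz steps), each summand being a two-pair form of part
  XXXVIII-e₁ (`smul_cup_cup_polar_polar_cupPow`) or of the first bullet at `k + 1`.
Together with part XXXVIII-e₁ this expresses every `u v w y_a y_c y_e θᵏ` through the "trace forms" `x x' θ^{g-1}` (`x, x' ∈ H¹`) and `θ^g` —
the 15 perfect matchings of `{u, v, w, y_a, y_c, y_e}`. The traced TRIPLE sum `Σ_{a,c,e} τ(x y_a y_c y_e θᵏ) b_a b_c b_e = α x + β θ ∧ C_τ(x)`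
(`C_τ` the `τ`-contraction of `⋀³H¹`) and the resulting Kleiman identity of the block `b = 2` are owed (o123).

## Documentary interface

PRINT: Kleiman, Dix exposés, App. to §2, 2A8–2A11; [MumfordAV1970, §1 (4), §16]; [LangeBirkenhake1992, Lemma 1.1.17]. LEAN: displayed theorems,
definition-free, fact-free.
-/

noncomputable section

set_option linter.dupNamespace false

namespace Summit.HodgeConjecture.HodgeConjecture.Ring2.AbelianAll

open CategoryTheory MonoidalCategory CartesianMonoidalCategory
open Literature.AlgebraicTopology.SingularHomology
open Literature.AlgebraicTopology.CharacteristicClasses (cupPow cupPow_zero cupPow_succ)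
open Literature.AlgebraicGeometry.Motives (SchemeOver ComplexPoints IsSmoothProjective bettiCohomology AbelianVariety)
open Literature.AlgebraicGeometry.HodgeTheory
open Summit.HodgeConjecture.CorCM.Model
open scoped MonObj

variable (A : AbelianVariety ℂ)

/-- **`(k+1) · u ∪ (v ∪ (w ∪ (y_a ∪ θᵏ))) = b^*_a(w) · u ∪ (v ∪ θ^{k+1}) − b^*_a(v) · u ∪ (w ∪ θ^{k+1}) + b^*_a(u) · v ∪ (w ∪ θ^{k+1})`** for
`k + 2 = dim A`, `u, v, w ∈ H¹(A(ℂ); ℚ)` and the polar family `y` of `θ` along a basis `b`: `(k+1) y_a θᵏ = D_a(θ^{k+1})`, three Leibniz steps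
`x ∪ D_a z = b^*_a(x) z − D_a(x ∪ z)`, and `u v w θ^{k+1} = 0` (degree `2 dim A + 1`). [cite: MumfordAV1970, §16] [cite: Kleiman1968AlgebraicCycles, App. to §2, 2A8–2A10] -/
theorem smul_cup_cup_cup_polar_cupPow {n k : ℕ} (hk : k + 2 = A.dim) (b : Module.Basis (Fin n) ℚ (bettiCohomology A.X 1))
    {θ : bettiCohomology A.X 2} {y : Fin n → bettiCohomology A.X 1}
    (hℓ : BettiUniverse.pull μ[A.X] 2 θ - BettiUniverse.pull (fst A.X A.X) 2 θ - BettiUniverse.pull (snd A.X A.X) 2 θ =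
      ∑ a, BettiUniverse.cup (A.X ⊗ A.X) 1 1 (BettiUniverse.pull (fst A.X A.X) 1 (b a))
        (BettiUniverse.pull (snd A.X A.X) 1 (y a)))
    (a : Fin n) (u v w : bettiCohomology A.X 1) :
    ((k + 1 : ℕ) : ℚ) • cupProduct (Nat.add_comm 1 (2 * k + 1 + 1 + 1)) u
        (cupProduct (Nat.add_comm 1 (2 * k + 1 + 1)) v
          (cupProduct (Nat.add_comm 1 (2 * k + 1)) w
            (cupProduct (show 1 + 2 * k = 2 * k + 1 by omega) (y a) (cupPow ℚ θ k)))) =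
      b.coord a w • cupProduct (Nat.add_comm 1 (2 * k + 1 + 1 + 1)) u (cupProduct (Nat.add_comm 1 (2 * k + 1 + 1)) v (cupPow ℚ θ (k + 1))) -
        b.coord a v • cupProduct (Nat.add_comm 1 (2 * k + 1 + 1 + 1)) u (cupProduct (Nat.add_comm 1 (2 * k + 1 + 1)) w (cupPow ℚ θ (k + 1))) +
        b.coord a u • cupProduct (Nat.add_comm 1 (2 * k + 1 + 1 + 1)) v (cupProduct (Nat.add_comm 1 (2 * k + 1 + 1)) w (cupPow ℚ θ (k + 1))) := by
  have h := hasExteriorCohomologyH1_rat A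
  have hex := fun c : Fin n ↦ exists_contraction h (b.coord c)
  choose D hD using hex
  haveI : Subsingleton (singularCohomology ℚ ℚ (ComplexPoints A.X) (2 * k + 1 + 1 + 1 + 1 + 1)) :=
    subsingleton_bettiCohomology_of_lt A (by omega)
  -- `(k+1) y_a θᵏ = D_a(θ^{k+1})`
  have e0 : ((k + 1 : ℕ) : ℚ) • cupProduct (show 1 + 2 * k = 2 * k + 1 by omega) (y a) (cupPow ℚ θ k) =
      D a (2 * k + 1) (cupPow ℚ θ (k + 1)) := by
    rw [polarFamily_eq_contraction A b hℓ D hD a]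
    exact (contraction_cupPow (b.coord a) (D a) h (hD a) θ k).symm
  -- three Leibniz steps
  have e1 := contraction_cup_one (b.coord a) (D a) h (hD a) (2 * k + 1) w (cupPow ℚ θ (k + 1))
  have e2 := contraction_cup_one (b.coord a) (D a) h (hD a) (2 * k + 1 + 1) v
    (cupProduct (Nat.add_comm 1 (2 * k + 1 + 1)) w (cupPow ℚ θ (k + 1)))
  have e3 := contraction_cup_one (b.coord a) (D a) h (hD a) (2 * k + 1 + 1 + 1) u
    (cupProduct (Nat.add_comm 1 (2 * k + 1 + 1 + 1)) v (cupProduct (Nat.add_comm 1 (2 * k + 1 + 1)) w (cupPow ℚ θ (k + 1))))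
  have htop : cupProduct (Nat.add_comm 1 (2 * k + 1 + 1 + 1 + 1)) u
      (cupProduct (Nat.add_comm 1 (2 * k + 1 + 1 + 1)) v (cupProduct (Nat.add_comm 1 (2 * k + 1 + 1)) w (cupPow ℚ θ (k + 1)))) = 0 :=
    Subsingleton.elim _ _
  rw [htop, map_zero] at e3
  -- `x ∪ D z = φ x • z − D (x ∪ z)` three times
  rw [← map_smul, ← map_smul, ← map_smul, e0, show cupProduct (Nat.add_comm 1 (2 * k + 1)) w (D a (2 * k + 1) (cupPow ℚ θ (k + 1))) =
      b.coord a w • cupPow ℚ θ (k + 1) - D a (2 * k + 1 + 1) (cupProduct (Nat.add_comm 1 (2 * k + 1 + 1)) w (cupPow ℚ θ (k + 1))) by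
        rw [e1, sub_sub_cancel],
    map_sub, map_smul, show cupProduct (Nat.add_comm 1 (2 * k + 1 + 1)) v
      (D a (2 * k + 1 + 1) (cupProduct (Nat.add_comm 1 (2 * k + 1 + 1)) w (cupPow ℚ θ (k + 1)))) =
      b.coord a v • cupProduct (Nat.add_comm 1 (2 * k + 1 + 1)) w (cupPow ℚ θ (k + 1)) -
        D a (2 * k + 1 + 1 + 1) (cupProduct (Nat.add_comm 1 (2 * k + 1 + 1 + 1)) v
          (cupProduct (Nat.add_comm 1 (2 * k + 1 + 1)) w (cupPow ℚ θ (k + 1)))) by rw [e2, sub_sub_cancel],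
    map_sub, map_sub, map_smul, map_smul, show cupProduct (Nat.add_comm 1 (2 * k + 1 + 1 + 1)) u
      (D a (2 * k + 1 + 1 + 1) (cupProduct (Nat.add_comm 1 (2 * k + 1 + 1 + 1)) v
        (cupProduct (Nat.add_comm 1 (2 * k + 1 + 1)) w (cupPow ℚ θ (k + 1))))) =
      b.coord a u • cupProduct (Nat.add_comm 1 (2 * k + 1 + 1 + 1)) v (cupProduct (Nat.add_comm 1 (2 * k + 1 + 1)) w (cupPow ℚ θ (k + 1))) by
        rw [eq_comm, ← sub_eq_zero, ← e3]]
  abel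

/-- **THE THREE-PAIR MATCHING STEP.** For `k + 3 = dim A`, a basis `b`, the polar family `y` of `θ`, indices `a, c, e` and `u, v, w ∈ H¹(A(ℂ); ℚ)`:
`(k+1) · u v w y_a y_c y_e θᵏ = b^*_e(y_c) · u v w y_a θ^{k+1} − b^*_e(y_a) · u v w y_c θ^{k+1} + b^*_e(w) · u v y_a y_c θ^{k+1} − b^*_e(v) · u w y_a y_c θ^{k+1}
 + b^*_e(u) · v w y_a y_c θ^{k+1}` (all products right-nested): `(k+1) y_e θᵏ = D_e(θ^{k+1})`, five Leibniz steps, `u v w y_a y_c θ^{k+1} = 0`. Each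
summand is a two-pair form (part XXXVIII-e₁) or a three-plain-one-polar form (`smul_cup_cup_cup_polar_cupPow`) at `k + 1`.
[cite: MumfordAV1970, §16] [cite: Kleiman1968AlgebraicCycles, App. to §2, 2A8–2A10] -/
theorem smul_cup6_polar3_cupPow {n k : ℕ} (hk : k + 3 = A.dim) (b : Module.Basis (Fin n) ℚ (bettiCohomology A.X 1))
    {θ : bettiCohomology A.X 2} {y : Fin n → bettiCohomology A.X 1}
    (hℓ : BettiUniverse.pull μ[A.X] 2 θ - BettiUniverse.pull (fst A.X A.X) 2 θ - BettiUniverse.pull (snd A.X A.X) 2 θ =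
      ∑ a, BettiUniverse.cup (A.X ⊗ A.X) 1 1 (BettiUniverse.pull (fst A.X A.X) 1 (b a))
        (BettiUniverse.pull (snd A.X A.X) 1 (y a)))
    (a c e : Fin n) (u v w : bettiCohomology A.X 1) :
    ((k + 1 : ℕ) : ℚ) • cupProduct (Nat.add_comm 1 (2 * k + 1 + 1 + 1 + 1 + 1)) u
        (cupProduct (Nat.add_comm 1 (2 * k + 1 + 1 + 1 + 1)) v
          (cupProduct (Nat.add_comm 1 (2 * k + 1 + 1 + 1)) w
            (cupProduct (Nat.add_comm 1 (2 * k + 1 + 1)) (y a)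
              (cupProduct (Nat.add_comm 1 (2 * k + 1)) (y c)
                (cupProduct (show 1 + 2 * k = 2 * k + 1 by omega) (y e) (cupPow ℚ θ k)))))) =
      b.coord e (y c) • cupProduct (Nat.add_comm 1 (2 * k + 1 + 1 + 1 + 1 + 1)) u
          (cupProduct (Nat.add_comm 1 (2 * k + 1 + 1 + 1 + 1)) v
            (cupProduct (Nat.add_comm 1 (2 * k + 1 + 1 + 1)) w
              (cupProduct (Nat.add_comm 1 (2 * k + 1 + 1)) (y a) (cupPow ℚ θ (k + 1))))) -
        b.coord e (y a) • cupProduct (Nat.add_comm 1 (2 * k + 1 + 1 + 1 + 1 + 1)) u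
          (cupProduct (Nat.add_comm 1 (2 * k + 1 + 1 + 1 + 1)) v
            (cupProduct (Nat.add_comm 1 (2 * k + 1 + 1 + 1)) w
              (cupProduct (Nat.add_comm 1 (2 * k + 1 + 1)) (y c) (cupPow ℚ θ (k + 1))))) +
        b.coord e w • cupProduct (Nat.add_comm 1 (2 * k + 1 + 1 + 1 + 1 + 1)) u
          (cupProduct (Nat.add_comm 1 (2 * k + 1 + 1 + 1 + 1)) v
            (cupProduct (Nat.add_comm 1 (2 * k + 1 + 1 + 1)) (y a)
              (cupProduct (Nat.add_comm 1 (2 * k + 1 + 1)) (y c) (cupPow ℚ θ (k + 1))))) -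
        b.coord e v • cupProduct (Nat.add_comm 1 (2 * k + 1 + 1 + 1 + 1 + 1)) u
          (cupProduct (Nat.add_comm 1 (2 * k + 1 + 1 + 1 + 1)) w
            (cupProduct (Nat.add_comm 1 (2 * k + 1 + 1 + 1)) (y a)
              (cupProduct (Nat.add_comm 1 (2 * k + 1 + 1)) (y c) (cupPow ℚ θ (k + 1))))) +
        b.coord e u • cupProduct (Nat.add_comm 1 (2 * k + 1 + 1 + 1 + 1 + 1)) v
          (cupProduct (Nat.add_comm 1 (2 * k + 1 + 1 + 1 + 1)) w
            (cupProduct (Nat.add_comm 1 (2 * k + 1 + 1 + 1)) (y a)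
              (cupProduct (Nat.add_comm 1 (2 * k + 1 + 1)) (y c) (cupPow ℚ θ (k + 1))))) := by
  have h := hasExteriorCohomologyH1_rat A
  have hex := fun c : Fin n ↦ exists_contraction h (b.coord c)
  choose D hD using hex
  haveI : Subsingleton (singularCohomology ℚ ℚ (ComplexPoints A.X) (2 * k + 1 + 1 + 1 + 1 + 1 + 1 + 1)) :=
    subsingleton_bettiCohomology_of_lt A (by omega)
  -- `(k+1) y_e θᵏ = D_e(θ^{k+1})`
  have e0 : ((k + 1 : ℕ) : ℚ) • cupProduct (show 1 + 2 * k = 2 * k + 1 by omega) (y e) (cupPow ℚ θ k) =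
      D e (2 * k + 1) (cupPow ℚ θ (k + 1)) := by
    rw [polarFamily_eq_contraction A b hℓ D hD e]
    exact (contraction_cupPow (b.coord e) (D e) h (hD e) θ k).symm
  -- the Leibniz rule as `x ∪ D z = φ x • z − D (x ∪ z)`
  have leib : ∀ (d : ℕ) (x : bettiCohomology A.X 1) (z : bettiCohomology A.X (d + 1)),
      cupProduct (Nat.add_comm 1 d) x (D e d z) = b.coord e x • z - D e (d + 1) (cupProduct (Nat.add_comm 1 (d + 1)) x z) := by
    intro d x z
    rw [contraction_cup_one (b.coord e) (D e) h (hD e) d x z, sub_sub_cancel]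
  have htop : cupProduct (Nat.add_comm 1 (2 * k + 1 + 1 + 1 + 1 + 1 + 1)) u
      (cupProduct (Nat.add_comm 1 (2 * k + 1 + 1 + 1 + 1 + 1)) v
        (cupProduct (Nat.add_comm 1 (2 * k + 1 + 1 + 1 + 1)) w
          (cupProduct (Nat.add_comm 1 (2 * k + 1 + 1 + 1)) (y a)
            (cupProduct (Nat.add_comm 1 (2 * k + 1 + 1)) (y c) (cupPow ℚ θ (k + 1)))))) = 0 :=
    Subsingleton.elim _ _
  rw [← map_smul, ← map_smul, ← map_smul, ← map_smul, ← map_smul, e0]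
  simp only [leib, map_sub, map_smul, htop, map_zero, sub_zero]
  abel

end Summit.HodgeConjecture.HodgeConjecture.Ring2.AbelianAll

end
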